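import Literature.Analysis.FluidPDE.StationaryEulerStep
import Literature.Analysis.FluidPDE.StationaryEulerLaminatesHighDim
import HarnessLib

/-!
# Tools for the stub `stub_boxStep` — the perturbation step in the unit box of `ℝ³`, with pressure
(crux `PointSink.PointFluxCone`, stmt-AnomalousDissipation-19033, line `Sketch`)

§2 Step 3 of Choffrut–Székelyhidi 2014 ("property (P) with an easy covering and rescaling
argument") is implemented in the tree on the flat torus (`StationaryEuler.exists_pointData`,
`StationaryEuler.step`, file `Literature/Analysis/FluidPDE/StationaryEulerStep.lean`).  The stub
`stub_boxStep` is the same statement in the open unit box `(0,1)³ ⊂ ℝ³` with the packet pressure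
`prC` carried along.  This file collects the tools of the adaptation:

* the pressure of rescaled / placed packets (`prC` is a sum of second derivatives of the potentials,
  hence transported by the rescaling `φ ↦ s²φ(s⁻¹(x − x₀))` exactly like the field), and its sup bound;
* re-boxing of a packet supported in a rotated unit cube into the axis cube keeping the sup bound of
  the pressure (`boxStep_exists_boxed`, the tree's `exists_boxed` with one more conclusion);
* the pointwise perturbation data with pressure (`boxStep_pointData`), from the hypothesis PPK of the
  stub (pressureless packets at relaxed states) and the joint margins of `HighDim.relaxedFamily`;
* on `ℝ^d` (no periodisation): fine grids make continuous functions oscillate little on the cells of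
  the fundamental cube, the grid packet's field is cellwise mean free, its energy is the sum of the
  energies of the copies, and it is nearly orthogonal to continuous test fields.

References: A. Choffrut, L. Székelyhidi Jr., *Weak solutions to the stationary incompressible Euler
equations*, SIAM J. Math. Anal. 46 (2014), §2 Step 3, Prop. 6, Cor. 16.
-/

noncomputable section

open scoped InnerProductSpace ContDiff ENNReal Topology
open Set Function MeasureTheory Metric Filter
open Literature.Analysis.FluidPDE Literature.Analysis.FluidPDE.StationaryEuler
open Literature.Analysis.FunctionSpaces

set_option linter.dupNamespace false

namespace Summit.AnomalousDissipation.AnomalousDissipation.Theorems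

variable {d : Type*} [Fintype d] [DecidableEq d]

/-! ## The pressure of rescaled and placed packets -/

/-- **Transport of the pressure under rescaling**: `prC (rescale x₀ s P) x = prC P (s⁻¹(x − x₀))`
(homogeneity of order two of `φ ↦ s²φ(s⁻¹(· − x₀))` on second derivatives). [folklore] -/
theorem boxStep_prC_rescale (x₀ : Ed d) {s : ℝ} (hs : s ≠ 0) (P : Packet d) (x : Ed d) :
    Packet.prC (Packet.rescale x₀ s hs P) x = Packet.prC P (s⁻¹ • (x - x₀)) := by
  -- adapted from Literature/Analysis/FluidPDE/StationaryEulerWavePackets.lean (`Packet.field_rescale`)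
  induction P with
  | nil => rfl
  | cons τ P ih =>
    simp only [Packet.rescale, List.map_cons, Packet.prC_cons] at ih ⊢
    rw [ih]
    congr 2
    refine Finset.sum_congr rfl fun m _ => ?_
    show τ.cert.strS (WaveCert.rescale x₀ s τ.φ) m m x = τ.cert.strS τ.φ m m (s⁻¹ • (x - x₀))
    simp only [WaveCert.strS, WaveCert.pd_pd_rescale τ.smooth x₀ hs]

/-- The pressure of a concatenation of packets. [folklore] -/
theorem boxStep_prC_append (P P' : Packet d) (x : Ed d) :
    Packet.prC (P ++ P') x = Packet.prC P x + Packet.prC P' x := by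
  induction P with
  | nil => simp
  | cons τ P ih => rw [List.cons_append, Packet.prC_cons, Packet.prC_cons, ih, add_assoc]

/-- The pressure of a `flatMap` of packets. [folklore] -/
theorem boxStep_prC_flatMap {ι : Type*} (L : List ι) (f : ι → Packet d) (x : Ed d) :
    Packet.prC (L.flatMap f) x = (L.map fun i => Packet.prC (f i) x).sum := by
  -- adapted from Literature/Analysis/FluidPDE/StationaryEulerLaminateWaves.lean (`field_flatMap`)
  induction L with
  | nil => rfl
  | cons i L ih => rw [List.flatMap_cons, boxStep_prC_append, ih, List.map_cons, List.sum_cons]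

/-- **Pressure of the placed packet**: `Σ_{κ ∈ S} prC (Q κ) (m (x − corner κ))`. [folklore] -/
theorem boxStep_prC_placed (F : Ed d ≃ₗᵢ[ℝ] Ed d) {m : ℕ} (hm : 0 < m) (S : Finset (d → ℤ))
    (Q : (d → ℤ) → Packet d) (x : Ed d) :
    Packet.prC (placed F hm S Q) x = ∑ κ ∈ S, Packet.prC (Q κ) ((m : ℝ) • (x - corner F m κ)) := by
  -- adapted from Literature/Analysis/FluidPDE/StationaryEulerLaminateWaves.lean (`field_placed`)
  rw [placed, boxStep_prC_flatMap]
  simp only [boxStep_prC_rescale, inv_inv, Finset.sum_map_toList]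

/-- The pressure of a rescaled copy vanishes off its cube. [folklore] -/
theorem boxStep_prC_rescale_eq_zero (F : Ed d ≃ₗᵢ[ℝ] Ed d) {m : ℕ} (hm : 0 < m) {Q : Packet d}
    (hQ : Packet.SuppIn (refCube F) Q) {κ : d → ℤ} {x : Ed d} (hx : x ∉ acube F m κ) :
    Packet.prC Q ((m : ℝ) • (x - corner F m κ)) = 0 := by
  -- adapted from Literature/Analysis/FluidPDE/StationaryEulerLaminateWaves.lean (`field_rescale_eq_zero`)
  have h := Packet.prC_eq_zero (suppIn_rescale_acube F hm hQ κ) hx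
  rwa [boxStep_prC_rescale, inv_inv] at h

/-- **Sup bound of the pressure of a placed packet**: if every reference packet has `|prC| ≤ δ`
then so does the placed packet (on the cube `κ₀` the pressure is the pressure of the single copy
`κ₀` at a rescaled point, off the cubes it vanishes). [folklore] -/
theorem boxStep_abs_prC_placed_le (F : Ed d ≃ₗᵢ[ℝ] Ed d) {m : ℕ} (hm : 0 < m) (S : Finset (d → ℤ))
    {Q : (d → ℤ) → Packet d} (hQ : ∀ κ ∈ S, Packet.SuppIn (refCube F) (Q κ)) {δ : ℝ} (hδ : 0 ≤ δ)
    (hQδ : ∀ κ ∈ S, ∀ y, |Packet.prC (Q κ) y| ≤ δ) (x : Ed d) :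
    |Packet.prC (placed F hm S Q) x| ≤ δ := by
  rw [boxStep_prC_placed]
  by_cases hx : ∃ κ ∈ S, x ∈ acube F m κ
  · obtain ⟨κ₀, hκ₀, hx₀⟩ := hx
    rw [Finset.sum_eq_single_of_mem κ₀ hκ₀ fun κ hκS hκ =>
      boxStep_prC_rescale_eq_zero F hm (hQ κ hκS) fun h => (disjoint_acube hm hκ).ne_of_mem h hx₀ rfl]
    exact hQδ κ₀ hκ₀ _
  · push Not at hx
    rw [Finset.sum_eq_zero fun κ hκ => boxStep_prC_rescale_eq_zero F hm (hQ κ hκ) (hx κ hκ), abs_zero]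
    exact hδ

/-! ## Re-boxing with the pressure bound -/

/-- **Re-boxing, with pressure**: a packet supported in a rotated unit cube `refCube F` with
`|prC| ≤ δ` can be replaced by a packet supported in the axis cube `(0,1)^d` whose field takes only
values of the original field (or `0`), whose energy is smaller by at most `ε`, and whose pressure is
still `≤ δ` in absolute value (fill `(0,1)^d` up to measure `ε'` by `F`-aligned cubes of a fine mesh
and place a rescaled copy in each). [cite: ChoffrutSzekelyhidi2014, §2, Step 3] -/
theorem boxStep_exists_boxed (F : Ed d ≃ₗᵢ[ℝ] Ed d) {P : Packet d} (hP : Packet.SuppIn (refCube F) P)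
    {ε : ℝ} (hε : 0 < ε) {δ : ℝ} (hδ : 0 ≤ δ) (hPδ : ∀ y, |Packet.prC P y| ≤ δ) :
    ∃ P' : Packet d, Packet.SuppIn (box d) P' ∧
      (∀ x, Packet.field P' x = 0 ∨ ∃ y, Packet.field P' x = Packet.field P y) ∧
      (∫ x, ‖Packet.field P x‖ ^ 2) - ε ≤ ∫ x, ‖Packet.field P' x‖ ^ 2 ∧
      ∀ x, |Packet.prC P' x| ≤ δ := by
  -- adapted from Literature/Analysis/FluidPDE/StationaryEulerSubsolutions.lean (`exists_boxed`)
  set E : ℝ := ∫ x, ‖Packet.field P x‖ ^ 2 with hE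
  have hE0 : 0 ≤ E := integral_nonneg fun x => by positivity
  set e' : ℝ := ε / (E + 1) with he'
  have he'0 : 0 < e' := by positivity
  have he'1 : e' * E ≤ ε := by
    rw [he', div_mul_eq_mul_div, div_le_iff₀ (by positivity)]; nlinarith
  have hfin : volume (box d) ≠ ⊤ := by rw [volume_box]; exact ENNReal.one_ne_top
  obtain ⟨m, hm0, S, hS_sub, hS_vol⟩ :=
    exists_acubes_subset (R := F) isOpen_box hfin (ENNReal.ofReal_pos.2 he'0).ne' 0
  have hm : 0 < m := hm0
  have hcube : ∀ κ ∈ S, acube F m κ ⊆ box d := fun κ hκ => (acube_subset_acubeClosed m κ).trans (hS_sub κ hκ)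
  set P' : Packet d := placed F hm S (fun _ => P) with hP'
  refine ⟨P', (suppIn_placed F hm S fun _ _ => hP).mono (iUnion₂_subset hcube), fun x => ?_, ?_,
    boxStep_abs_prC_placed_le F hm S (fun _ _ => hP) hδ (fun _ _ => hPδ)⟩
  · by_cases hx : ∃ κ ∈ S, x ∈ acube F m κ
    · obtain ⟨κ, hκ, hxκ⟩ := hx
      exact Or.inr ⟨_, field_placed_of_mem F hm S (fun _ _ => hP) hκ hxκ⟩
    · push Not at hx
      exact Or.inl (field_placed_of_not_mem F hm S (fun _ _ => hP) hx)
  · -- energy of the boxed packet: `#S m^{-d} E ≥ (1 - e') E`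
    have hint : Integrable fun x => ‖Packet.field P' x‖ ^ 2 := integrable_sq_field _
    have hU : ∫ x, ‖Packet.field P' x‖ ^ 2 = ∫ x in ⋃ κ ∈ S, acube F m κ, ‖Packet.field P' x‖ ^ 2 := by
      refine (setIntegral_eq_integral_of_forall_compl_eq_zero fun x hx => ?_).symm
      rw [field_placed_of_not_mem F hm S (fun _ _ => hP) fun κ hκ hxκ => hx (mem_iUnion₂.2 ⟨κ, hκ, hxκ⟩),
        norm_zero]
      norm_num
    have hsum : ∫ x in ⋃ κ ∈ S, acube F m κ, ‖Packet.field P' x‖ ^ 2 =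
        ∑ κ ∈ S, ((m : ℝ)⁻¹) ^ Fintype.card d * E := by
      rw [integral_biUnion_finset _ (fun κ _ => measurableSet_acube m κ) (fun κ _ κ' _ h => disjoint_acube hm h)
        fun κ _ => hint.integrableOn]
      refine Finset.sum_congr rfl fun κ hκ => ?_
      rw [setIntegral_congr_fun (measurableSet_acube m κ) fun x hx => by
        rw [field_placed_of_mem F hm S (fun _ _ => hP) hκ hx, show Packet.field P ((m : ℝ) • (x - corner F m κ)) =
          0 + Packet.field P ((m : ℝ) • (x - corner F m κ)) from (zero_add _).symm]]
      rw [setIntegral_sq_const_add F hm hP κ 0, norm_zero]; ring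
    -- the covered volume
    have hm' : (0 : ℝ) < m := by exact_mod_cast hm
    have hvolU : volume.real (⋃ κ ∈ S, acube F m κ) = S.card * ((m : ℝ)⁻¹) ^ Fintype.card d := by
      rw [measureReal_def, volume_biUnion_acube hm, ENNReal.toReal_mul, ENNReal.toReal_pow,
        ENNReal.toReal_ofReal (inv_nonneg.2 hm'.le)]
      simp
    have hcov : 1 - e' ≤ volume.real (⋃ κ ∈ S, acube F m κ) := by
      have hsub : (⋃ κ ∈ S, acube F m κ) ⊆ box d := iUnion₂_subset hcube
      have h2 : volume (box d \ ⋃ κ ∈ S, acube F m κ) ≤ ENNReal.ofReal e' := hS_vol.le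
      have h3 : (1 : ℝ≥0∞) ≤ volume (⋃ κ ∈ S, acube F m κ) + ENNReal.ofReal e' := by
        calc (1 : ℝ≥0∞) = volume (box d) := volume_box.symm
          _ ≤ volume ((⋃ κ ∈ S, acube F m κ) ∪ (box d \ ⋃ κ ∈ S, acube F m κ)) :=
              measure_mono fun x hx => by
                by_cases h : x ∈ ⋃ κ ∈ S, acube F m κ
                · exact Or.inl h
                · exact Or.inr ⟨hx, h⟩
          _ ≤ volume (⋃ κ ∈ S, acube F m κ) + volume (box d \ ⋃ κ ∈ S, acube F m κ) := measure_union_le _ _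
          _ ≤ _ := by gcongr
      have hfinU : volume (⋃ κ ∈ S, acube F m κ) ≠ ⊤ := ne_top_of_le_ne_top hfin (measure_mono hsub)
      have h4 := ENNReal.toReal_mono (ENNReal.add_ne_top.2 ⟨hfinU, ENNReal.ofReal_ne_top⟩) h3
      rw [ENNReal.toReal_one, ENNReal.toReal_add hfinU ENNReal.ofReal_ne_top, ENNReal.toReal_ofReal he'0.le] at h4
      rw [measureReal_def]; linarith
    rw [hU, hsum, Finset.sum_const, nsmul_eq_mul, ← mul_assoc, ← hvolU]
    have key : (1 - e') * E ≤ volume.real (⋃ κ ∈ S, acube F m κ) * E := mul_le_mul_of_nonneg_right hcov hE0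
    nlinarith [key, he'1]

/-! ## Pointwise perturbation data with pressure -/

/-- **Pointwise perturbation data, with pressure** at a relaxed state `w₀ ∈ 𝒰_r` (`d = 3`): from
the pressureless packets of the hypothesis PPK of the stub, re-boxed into the axis cube, a packet
with a uniform joint margin `δ'` (all admissible states within `δ'` of a value `w₀ + field P y` lie in
`𝒰_{r'}` for all `|r' − r| < δ'`), energy at least `r − |v̄|² − η`, and pressure `|prC| ≤ δ`.
[cite: ChoffrutSzekelyhidi2014, §2, Step 3; Cor. 16] -/
theorem boxStep_pointData
    (hPPK : ∀ (r : ℝ) (w : State (Fin 3)) (ε δ : ℝ), w ∈ HighDim.U r → 0 < ε → 0 < δ →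
      ∃ (F : Ed (Fin 3) ≃ₗᵢ[ℝ] Ed (Fin 3)) (P : Packet (Fin 3)), P.SuppIn (refCube F) ∧
        (∀ x, w + P.field x ∈ HighDim.U r) ∧
        r - ‖vel w‖ ^ 2 - ε ≤ ∫ x, ‖P.field x‖ ^ 2 ∧
        ∀ x, |P.prC x| ≤ δ)
    {r : ℝ} {w₀ : State (Fin 3)} (hw : w₀ ∈ HighDim.U r) {η δ : ℝ} (hη : 0 < η) (hδ : 0 < δ) :
    ∃ (P : Packet (Fin 3)) (δ' : ℝ), 0 < δ' ∧ Packet.SuppIn (box (Fin 3)) P ∧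
      (∀ r' w', |r' - r| < δ' → IsAdm w' → ∀ y, dist w' (w₀ + Packet.field P y) < δ' → w' ∈ HighDim.U r') ∧
      r - ‖vel w₀‖ ^ 2 - η ≤ ∫ y, ‖Packet.field P y‖ ^ 2 ∧
      ∀ y, |Packet.prC P y| ≤ δ := by
  -- adapted from Literature/Analysis/FluidPDE/StationaryEulerStep.lean (`exists_pointData`)
  have hη2 : 0 < η / 2 := by positivity
  obtain ⟨F, P₀, hP₀supp, hP₀U, hP₀gain, hP₀δ⟩ := hPPK r w₀ (η / 2) δ hw hη2 hδ
  obtain ⟨P', hP'supp, hP'vals, hP'gain, hP'δ⟩ := boxStep_exists_boxed F hP₀supp hη2 hδ.le hP₀δ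
  have hd : 3 ≤ Fintype.card (Fin 3) := by simp
  -- the compact set of values and its joint margin
  set S : Set (State (Fin 3)) := range fun y => w₀ + Packet.field P' y with hS
  have hSc : IsCompact S := by
    rw [hS, show (fun y => w₀ + Packet.field P' y) = (fun z => w₀ + z) ∘ Packet.field P' from rfl, Set.range_comp]
    exact (isCompact_range_field P').image (continuous_const.add continuous_id)
  have hSU : S ⊆ (HighDim.relaxedFamily hd).U r := by
    rintro s ⟨y, rfl⟩
    show w₀ + Packet.field P' y ∈ HighDim.U r
    rcases hP'vals y with h0 | ⟨z, hz⟩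
    · rw [h0, add_zero]; exact hw
    · rw [hz]; exact hP₀U z
  obtain ⟨δ', hδ', hmarg⟩ := (HighDim.relaxedFamily hd).exists_jmargin hSc hSU
  refine ⟨P', δ', hδ', hP'supp, fun r' w' hr hw' y hd' => hmarg _ ⟨y, rfl⟩ r' w' hr hw' hd', ?_, hP'δ⟩
  linarith

/-! ## Grid packets on `ℝ^d`: cells, mean zero, energy, near-orthogonality -/

omit [Fintype d] [DecidableEq d] in
/-- The open unit box lies in the half-open fundamental cube. [folklore] -/
theorem boxStep_box_subset_unitCube : box d ⊆ Torus.unitCube d := fun _ hy i => Ioo_subset_Ico_self (hy i)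

/-- **Fine grids make continuous functions oscillate little on cells** (on `ℝ^d`): for continuous
`f` and `η > 0` there is `m₀` such that for all `m ≥ m₀`, `f` oscillates by at most `η` on every
cell of mesh `m⁻¹` of the fundamental cube (uniform continuity on the closed ball containing the
cube; cells have diameter `≤ √d / m`). [folklore] -/
theorem boxStep_exists_mesh_osc_le {E : Type*} [PseudoMetricSpace E] {f : Ed d → E} (hf : Continuous f)
    {η : ℝ} (hη : 0 < η) :
    ∃ m₀ : ℕ, 0 < m₀ ∧ ∀ m : ℕ, m₀ ≤ m → ∀ κ : d → Fin m, ∀ y ∈ Torus.latticeCell m (gridIdx κ),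
      ∀ y' ∈ Torus.latticeCell m (gridIdx κ), dist (f y) (f y') ≤ η := by
  -- adapted from Literature/Analysis/FluidPDE/StationaryEulerTorusGrid.lean (`exists_mesh_osc_le`)
  have hK : IsCompact (closedBall (0 : Ed d) (Fintype.card d)) := isCompact_closedBall _ _
  have huc := hK.uniformContinuousOn_of_continuous hf.continuousOn
  obtain ⟨δ, hδ, hδu⟩ := Metric.uniformContinuousOn_iff.1 huc η hη
  obtain ⟨m₀, hm₀⟩ := exists_nat_gt (Real.sqrt (Fintype.card d) / δ)
  have hm₀pos : 0 < m₀ := by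
    have : (0 : ℝ) < m₀ := lt_of_le_of_lt (div_nonneg (Real.sqrt_nonneg _) hδ.le) hm₀
    exact_mod_cast this
  refine ⟨m₀, hm₀pos, fun m hm κ y hy y' hy' => ?_⟩
  have hmpos : 0 < m := lt_of_lt_of_le hm₀pos hm
  have hyU := Torus.latticeCell_subset_unitCube hmpos κ hy
  have hy'U := Torus.latticeCell_subset_unitCube hmpos κ hy'
  have hdist : dist y y' < δ := by
    rw [dist_eq_norm, ← neg_sub, norm_neg]
    calc ‖y' - y‖ ≤ Real.sqrt (Fintype.card d) / m := Torus.norm_sub_le_of_mem_latticeCell hmpos hy hy'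
      _ ≤ Real.sqrt (Fintype.card d) / m₀ :=
          div_le_div_of_nonneg_left (Real.sqrt_nonneg _) (by exact_mod_cast hm₀pos) (by exact_mod_cast hm)
      _ < δ := by
          rw [div_lt_iff₀ (by exact_mod_cast hm₀pos : (0 : ℝ) < m₀)]
          calc Real.sqrt (Fintype.card d) = Real.sqrt (Fintype.card d) / δ * δ := by field_simp
            _ < m₀ * δ := by gcongr
            _ = δ * m₀ := mul_comm _ _
  exact (hδu y (Torus.unitCube_subset_closedBall hyU) y' (Torus.unitCube_subset_closedBall hy'U) hdist).le

section GridPacket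

variable {m : ℕ} (hm : 0 < m) {Q : (d → ℤ) → Packet d} (hQ : ∀ κ, Packet.SuppIn (box d) (Q κ))
include hQ

/-- **Cellwise mean zero** (on `ℝ^d`): on every cell of the fundamental cube the field of the grid
packet integrates to zero. [cite: ChoffrutSzekelyhidi2014, §2, Step 3] -/
theorem boxStep_setIntegral_cell_field_gridPacket (κ : d → Fin m) :
    ∫ y in Torus.latticeCell m (gridIdx κ), Packet.field (gridPacket hm Q) y = 0 := by
  rw [← setIntegral_cell_gridField hm hQ κ]
  exact setIntegral_congr_fun Torus.measurableSet_latticeCell fun y hy =>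
    (gridField_proj hm hQ (Torus.latticeCell_subset_unitCube hm κ hy)).symm

/-- **Energy of the grid packet** (on `ℝ^d`): `∫ ‖field‖² = Σ_κ m^{-d} ∫ ‖field (Q κ)‖²`. [folklore] -/
theorem boxStep_integral_sq_field_gridPacket :
    ∫ y, ‖Packet.field (gridPacket hm Q) y‖ ^ 2 =
      ∑ κ : d → Fin m, ((m : ℝ)⁻¹) ^ Fintype.card d * ∫ y, ‖Packet.field (Q (gridIdx κ)) y‖ ^ 2 := by
  rw [← Packet.integral_sq_tfield (suppIn_gridPacket hm hQ)]
  exact integral_sq_gridField hm hQ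

/-- **Near-orthogonality of fine increments to fixed continuous states** (on `ℝ^d`):
`|∫ ⟪field (gridPacket), p⟫| ≤ M η` when the reference fields are bounded by `M` and `p` oscillates
by at most `η` on the cells: on each cell subtract the value of `p` at the corner and use the
cellwise mean zero. [cite: ChoffrutSzekelyhidi2014, §2, Step 3] -/
theorem boxStep_abs_integral_inner_field_gridPacket_le {M η : ℝ} (hM0 : 0 ≤ M)
    (hM : ∀ κ y, ‖Packet.field (Q κ) y‖ ≤ M) {p : Ed d → State d} (hp : Continuous p)
    (hosc : ∀ κ : d → Fin m, ∀ y ∈ Torus.latticeCell m (gridIdx κ), ∀ y' ∈ Torus.latticeCell m (gridIdx κ),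
      dist (p y) (p y') ≤ η) :
    |∫ x, ⟪Packet.field (gridPacket hm Q) x, p x⟫_ℝ| ≤ M * η := by
  -- adapted from Literature/Analysis/FluidPDE/StationaryEulerTorusGrid.lean (`abs_integral_gridField_mul_le`)
  have hm' : (0 : ℝ) < m := by exact_mod_cast hm
  set W : Ed d → State d := Packet.field (gridPacket hm Q) with hW
  have hsupp := suppIn_gridPacket hm hQ
  have hWc : Continuous W := Packet.continuous_field _
  have hWM : ∀ y, ‖W y‖ ≤ M := norm_field_gridPacket_le hm hQ hM0 hM
  -- reduce to the fundamental cube and split into cells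
  have h1 : ∫ x, ⟪W x, p x⟫_ℝ = ∫ x in Torus.unitCube d, ⟪W x, p x⟫_ℝ := by
    refine (setIntegral_eq_integral_of_forall_compl_eq_zero fun x hx => ?_).symm
    rw [hW, Packet.field_eq_zero_of_suppIn hsupp fun h => hx (boxStep_box_subset_unitCube h), inner_zero_left]
  rw [h1, Torus.setIntegral_unitCube_eq_sum_latticeCell hm (Torus.integrableOn_unitCube_of_continuous (hWc.inner hp))]
  have hvol : ∀ κ : d → Fin m, volume.real (Torus.latticeCell m (gridIdx κ)) = ((m : ℝ)⁻¹) ^ Fintype.card d := fun κ => by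
    rw [measureReal_def, Torus.volume_latticeCell hm, ENNReal.toReal_pow, ENNReal.toReal_ofReal (inv_nonneg.2 hm'.le)]
  -- bound on each cell
  have hcell : ∀ κ : d → Fin m, |∫ y in Torus.latticeCell m (gridIdx κ), ⟪W y, p y⟫_ℝ| ≤
      M * η * ((m : ℝ)⁻¹) ^ Fintype.card d := fun κ => by
    set c : Ed d := corner frame0 m (gridIdx κ) with hc
    have hcmem : c ∈ Torus.latticeCell m (gridIdx κ) := corner_mem_latticeCell hm κ
    have hintW : IntegrableOn W (Torus.latticeCell m (gridIdx κ)) volume :=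
      (Torus.integrableOn_unitCube_of_continuous hWc).mono_set (Torus.latticeCell_subset_unitCube hm κ)
    have hint1 : IntegrableOn (fun y => ⟪W y, p y - p c⟫_ℝ) (Torus.latticeCell m (gridIdx κ)) volume :=
      (Torus.integrableOn_unitCube_of_continuous (hWc.inner (hp.sub continuous_const))).mono_set
        (Torus.latticeCell_subset_unitCube hm κ)
    have hsplit : (fun y => ⟪W y, p y⟫_ℝ) = fun y => ⟪W y, p y - p c⟫_ℝ + ⟪p c, W y⟫_ℝ := by
      funext y; rw [real_inner_comm (W y) (p c), ← inner_add_right, sub_add_cancel]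
    rw [hsplit, integral_add hint1 (hintW.const_inner _), integral_inner hintW,
      boxStep_setIntegral_cell_field_gridPacket hm hQ κ, inner_zero_right, add_zero, ← Real.norm_eq_abs, ← hvol κ]
    refine norm_setIntegral_le_of_norm_le_const (Torus.volume_latticeCell_ne_top hm).lt_top fun y hy => ?_
    calc ‖⟪W y, p y - p c⟫_ℝ‖ ≤ ‖W y‖ * ‖p y - p c‖ := norm_inner_le_norm _ _
      _ ≤ M * η := mul_le_mul (hWM y) (by rw [← dist_eq_norm]; exact hosc κ y hy c hcmem) (norm_nonneg _) hM0
  calc |∑ κ : d → Fin m, ∫ y in Torus.latticeCell m (gridIdx κ), ⟪W y, p y⟫_ℝ|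
      ≤ ∑ κ : d → Fin m, |∫ y in Torus.latticeCell m (gridIdx κ), ⟪W y, p y⟫_ℝ| := Finset.abs_sum_le_sum_abs _ _
    _ ≤ ∑ _κ : d → Fin m, M * η * ((m : ℝ)⁻¹) ^ Fintype.card d := Finset.sum_le_sum fun κ _ => hcell κ
    _ = M * η := by
        rw [Finset.sum_const, Finset.card_univ, Fintype.card_fun, Fintype.card_fin, nsmul_eq_mul, Nat.cast_pow,
          inv_pow, ← mul_assoc, mul_comm ((m : ℝ) ^ Fintype.card d), mul_assoc (M * η),
          mul_inv_cancel₀ (pow_ne_zero _ hm'.ne'), mul_one]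

end GridPacket

/-! ## The registered sub-stub closing this helper file -/

/-- **Tools of `stub_boxStep`** (registered sub-stub `stub_boxStepTools` of the crux, the
conjunction of the statements of this file used by the main file): pointwise perturbation data with
pressure from PPK; fine grids and oscillation of continuous functions on cells; near-orthogonality of
the grid packet's field to continuous states; the sup bound of the pressure of placed packets; the
energy of the grid packet; `box ⊆ unitCube`. [cite: ChoffrutSzekelyhidi2014, §2, Step 3] -/
theorem stub_boxStepTools :
    ((∀ (r : ℝ) (w : State (Fin 3)) (ε δ : ℝ), w ∈ HighDim.U r → 0 < ε → 0 < δ →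
      ∃ (F : Ed (Fin 3) ≃ₗᵢ[ℝ] Ed (Fin 3)) (P : Packet (Fin 3)), P.SuppIn (refCube F) ∧
        (∀ x, w + P.field x ∈ HighDim.U r) ∧
        r - ‖vel w‖ ^ 2 - ε ≤ ∫ x, ‖P.field x‖ ^ 2 ∧
        ∀ x, |P.prC x| ≤ δ) →
      ∀ (r : ℝ) (w₀ : State (Fin 3)), w₀ ∈ HighDim.U r → ∀ (η δ : ℝ), 0 < η → 0 < δ →
        ∃ (P : Packet (Fin 3)) (δ' : ℝ), 0 < δ' ∧ Packet.SuppIn (box (Fin 3)) P ∧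
          (∀ (r' : ℝ) (w' : State (Fin 3)), |r' - r| < δ' → IsAdm w' →
            ∀ y, dist w' (w₀ + Packet.field P y) < δ' → w' ∈ HighDim.U r') ∧
          r - ‖vel w₀‖ ^ 2 - η ≤ ∫ y, ‖Packet.field P y‖ ^ 2 ∧
          ∀ y, |Packet.prC P y| ≤ δ) ∧
    (∀ (f : Ed (Fin 3) → State (Fin 3)), Continuous f → ∀ (η : ℝ), 0 < η →
      ∃ m₀ : ℕ, 0 < m₀ ∧ ∀ m : ℕ, m₀ ≤ m → ∀ κ : Fin 3 → Fin m, ∀ y ∈ Torus.latticeCell m (gridIdx κ),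
        ∀ y' ∈ Torus.latticeCell m (gridIdx κ), dist (f y) (f y') ≤ η) ∧
    (∀ (m : ℕ) (hm : 0 < m) (Q : (Fin 3 → ℤ) → Packet (Fin 3)), (∀ κ, Packet.SuppIn (box (Fin 3)) (Q κ)) →
      ∀ (M η : ℝ), 0 ≤ M → (∀ κ y, ‖Packet.field (Q κ) y‖ ≤ M) → ∀ (p : Ed (Fin 3) → State (Fin 3)),
        Continuous p → (∀ κ : Fin 3 → Fin m, ∀ y ∈ Torus.latticeCell m (gridIdx κ),
          ∀ y' ∈ Torus.latticeCell m (gridIdx κ), dist (p y) (p y') ≤ η) →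
        |∫ x, ⟪Packet.field (gridPacket hm Q) x, p x⟫_ℝ| ≤ M * η) ∧
    (∀ (F : Ed (Fin 3) ≃ₗᵢ[ℝ] Ed (Fin 3)) (m : ℕ) (hm : 0 < m) (S : Finset (Fin 3 → ℤ))
      (Q : (Fin 3 → ℤ) → Packet (Fin 3)), (∀ κ ∈ S, Packet.SuppIn (refCube F) (Q κ)) → ∀ (δ : ℝ), 0 ≤ δ →
      (∀ κ ∈ S, ∀ y, |Packet.prC (Q κ) y| ≤ δ) → ∀ x, |Packet.prC (placed F hm S Q) x| ≤ δ) ∧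
    (∀ (m : ℕ) (hm : 0 < m) (Q : (Fin 3 → ℤ) → Packet (Fin 3)), (∀ κ, Packet.SuppIn (box (Fin 3)) (Q κ)) →
      ∫ y, ‖Packet.field (gridPacket hm Q) y‖ ^ 2 =
        ∑ κ : Fin 3 → Fin m, ((m : ℝ)⁻¹) ^ Fintype.card (Fin 3) * ∫ y, ‖Packet.field (Q (gridIdx κ)) y‖ ^ 2) ∧
    box (Fin 3) ⊆ Torus.unitCube (Fin 3) :=
  ⟨fun hP _ _ hw _ _ hη hδ => boxStep_pointData hP hw hη hδ,
    fun _ hf _ hη => boxStep_exists_mesh_osc_le hf hη,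
    fun _ hm _ hQ _ _ hM0 hM _ hp hosc => boxStep_abs_integral_inner_field_gridPacket_le hm hQ hM0 hM hp hosc,
    fun F _ hm S _ hQ _ hδ hQδ x => boxStep_abs_prC_placed_le F hm S hQ hδ hQδ x,
    fun _ hm _ hQ => boxStep_integral_sq_field_gridPacket hm hQ,
    boxStep_box_subset_unitCube⟩

end Summit.AnomalousDissipation.AnomalousDissipation.Theorems

end
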